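import Literature.MathematicalPhysics.QuantumLattice.HubbardQuadraticShift
import Literature.MathematicalPhysics.QuantumLattice.HubbardGridTadpoleFlow
import Literature.MathematicalPhysics.QuantumLattice.GrassmannLinearSubstitution
import HarnessLib

/-!
# The finite-`M` Grassmann two-point ratio of the Hubbard torus as a function of a COMPLEX coupling `u`

Topic `MathematicalPhysics/QuantumLattice`; cell gate-hubbard-kl, R0-SCOPE-4 P7 (representations of the continued two-point function).
At fixed real chemical potential `μ` the two-point ratio of the Hubbard torus at coupling `U` is, in the Grassmann representation with
`M` Matsubara pairs, the ratio `⟨ψ⁺_x ψ⁻_y e^{-V_U}⟩_{C_{μ-U/2}}/Z` (`HubbardThermalTwoPointMatsubaraLimit`).  Moving the shift `-U/2`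
of the chemical potential into the action (`HubbardQuadraticShift`) exhibits it as a ratio of POLYNOMIALS in the coupling with the
FIXED covariance `C_μ`:

`R_{L,M}(u) = ∫dμ_{C_μ} ψ⁺_x ψ⁻_y e^{-(u V₁ + (u/2) N̂)} / ∫dμ_{C_μ} e^{-(u V₁ + (u/2) N̂)}`   (`hubbardRatio`),

which makes sense for complex `u`:
* `hubbardRatio_ofReal` — for real `u` it is the ratio of the Grassmann representation at `μ - u/2`;
* `hubbardRatio_eq_grid` — for complex `u` and any `T` (Hartree constant) with `|β·Im(u/2 + uT)| ≤ π/4` it is the grid two-point ratio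
  of `HubbardGridTwoPointBound` with covariance `Sᵀ C^{θ}_{μ_R} S`, `μ_R + iθ = μ - u/2 - uT`, and interaction `gridTracked u (-uT)`
  (`2M ≤ N`, `4M ≤ N + 1`: the grid carries both the quartic and the quadratic vertex exactly);
* `differentiable_hubbardRatioNum/Den` — numerator and denominator are polynomials in `u` (the exponential is a finite sum), so the
  ratio is holomorphic wherever the denominator does not vanish.

Everything is proved; `hubbardComplexAction`, `hubbardRatioNum`, `hubbardRatioDen`, `hubbardRatio` are the only definitions; no named facts.

## Sources

G. Benfatto, A. Giuliani, V. Mastropietro, Ann. Henri Poincaré 7 (2006) 809–898, §2.1 (2.5)–(2.6a), §2.3 (2.21)–(2.24), Thm 2.1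
(`BenfattoGiulianiMastropietro2006`); M. Salmhofer, *Renormalization* (1999), §4.2.4, App. B.2 (B.23)–(B.25) (`Salmhofer1999`).
-/

noncomputable section

namespace Literature.MathematicalPhysics.QuantumLattice

open GrassmannAlgebra Finset Literature.Probability.LatticeModels Complex

variable {L M N : ℕ} [NeZero L]

/-! ### The interaction at complex coupling -/

/-- `V_U = U · V_1`. [cite: BenfattoGiulianiMastropietro2006, §2.1 (2.6a)] -/
theorem hubbardInteraction_eq_smul_one (β U : ℝ) : hubbardInteraction L M β U = (U : ℂ) • hubbardInteraction L M β 1 := by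
  rw [hubbardInteraction, hubbardInteraction, smul_smul]
  congr 1
  push_cast
  ring

variable (L M)

/-- **The complex action** `u V₁ + (u/2) N̂` (coupling `u`, the shift `-u/2` of the chemical potential moved into the action).
[cite: BenfattoGiulianiMastropietro2006, §2.3 (2.21)-(2.24)] -/
def hubbardComplexAction (β : ℝ) (u : ℂ) : HubbardGrassmann L M := u • hubbardInteraction L M β 1 + (u / 2) • momentumDensity L M β

/-- The numerator `∫dμ_{C_μ} ψ⁺_{xσ} ψ⁻_{yσ′} e^{-(uV₁ + (u/2)N̂)}`. [cite: BenfattoGiulianiMastropietro2006, Thm 2.1] -/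
def hubbardRatioNum (β μ : ℝ) (x y : TorusSite 2 L) (σ σ' : Fin 2) (u : ℂ) : ℂ :=
  gaussExpect ℂ (hubbardCovariance L M β μ 0)
    (positionField L M β 0 σ x 0 * positionField L M β 1 σ' y 0 * grassmannExp (-hubbardComplexAction L M β u))

/-- The denominator `∫dμ_{C_μ} e^{-(uV₁ + (u/2)N̂)}`. [cite: BenfattoGiulianiMastropietro2006, Thm 2.1] -/
def hubbardRatioDen (β μ : ℝ) (u : ℂ) : ℂ :=
  gaussExpect ℂ (hubbardCovariance L M β μ 0) (grassmannExp (-hubbardComplexAction L M β u))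

/-- **The two-point ratio at complex coupling.** [cite: BenfattoGiulianiMastropietro2006, Thm 2.1] -/
def hubbardRatio (β μ : ℝ) (x y : TorusSite 2 L) (σ σ' : Fin 2) (u : ℂ) : ℂ :=
  hubbardRatioNum L M β μ x y σ σ' u / hubbardRatioDen L M β μ u

variable {L M}

/-! ### Moving `e^{wN̂}` between action and covariance -/

/-- `e^{-(uV₁ + (u/2)N̂)} = e^{wN̂} e^{-(uV₁ + (w + u/2)N̂)}` for every `w` (the density commutes with everything).
[cite: BenfattoGiulianiMastropietro2006, §2.3 (2.23)] -/
theorem grassmannExp_neg_hubbardComplexAction_eq (β : ℝ) (u w : ℂ) :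
    grassmannExp (-hubbardComplexAction L M β u) =
      grassmannExp (w • momentumDensity L M β) * grassmannExp (-(u • hubbardInteraction L M β 1 + (w + u / 2) • momentumDensity L M β)) := by
  classical
  have hq := smul_momentumDensity_eq_sum (L := L) (M := M) β w
  have hcomm : Commute (w • momentumDensity L M β) (-(u • hubbardInteraction L M β 1 + (w + u / 2) • momentumDensity L M β)) :=
    commute_of_eq_quadratic _ hq _
  have hn1 : IsNilpotent (w • momentumDensity L M β) := isNilpotent_of_eq_quadratic _ hq
  have hV0 : constPart ℂ (hubbardInteraction L M β 1) = 0 := constPart_hubbardInteraction L M β 1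
  have hQ0 : constPart ℂ (momentumDensity L M β) = 0 := by
    have := constPart_eq_zero_of_eq_quadratic _ (smul_momentumDensity_eq_sum (L := L) (M := M) β 1)
    simpa using this
  have hn2 : IsNilpotent (-(u • hubbardInteraction L M β 1 + (w + u / 2) • momentumDensity L M β)) :=
    isNilpotent_of_constPart_eq_zero ℂ (by simp [hV0, hQ0])
  rw [grassmannExp, grassmannExp, grassmannExp, ← IsNilpotent.exp_add_of_commute hcomm hn1 hn2]
  congr 1
  rw [hubbardComplexAction]
  simp only [add_smul, neg_add]
  abel

/-- **The insertion identity for the ratio's building blocks**: with `w = -(u/2) - v` (any `v`, e.g. the Hartree constant `uT`) and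
`|β Im w| ≤ π/4`, `∫dμ_{C_μ} A e^{-(uV₁+(u/2)N̂)} = N_w · ∫dμ_{C^{Im w}_{μ + Re w}} A e^{-(uV₁ - vN̂)}` for every `A` commuting past `e^{wN̂}`
(here `A` = a product of fields or `1`). [cite: BenfattoGiulianiMastropietro2006, §2.3 (2.23)-(2.24)] -/
theorem gaussExpect_mul_grassmannExp_neg_hubbardComplexAction {β : ℝ} (hβ : 0 < β) (μ : ℝ) (u v : ℂ)
    (hw : |β * (-(u / 2) - v).im| ≤ Real.pi / 4) (A : HubbardGrassmann L M) :
    gaussExpect ℂ (hubbardCovariance L M β μ 0) (A * grassmannExp (-hubbardComplexAction L M β u)) =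
      gaussExpect ℂ (hubbardCovariance L M β μ 0) (grassmannExp ((-(u / 2) - v) • momentumDensity L M β)) *
        gaussExpect ℂ (hubbardCovFullShifted L M β (μ + (-(u / 2) - v).re) (-(u / 2) - v).im)
          (A * grassmannExp (-(u • hubbardInteraction L M β 1 + (-v) • momentumDensity L M β))) := by
  classical
  have hq := smul_momentumDensity_eq_sum (L := L) (M := M) β (-(u / 2) - v)
  have hsplit := grassmannExp_neg_hubbardComplexAction_eq (L := L) (M := M) β u (-(u / 2) - v)
  rw [show -(u / 2) - v + u / 2 = -v by ring] at hsplit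
  rw [hsplit, ← mul_assoc, ← (commute_grassmannExp_of_eq_quadratic _ hq A).eq, mul_assoc, ← hubbardCovFullShifted_zero]
  have h := gaussExpect_shifted_grassmannExp_smul_momentumDensity_mul (L := L) (M := M) hβ μ (θ := 0)
    (by rw [mul_zero, abs_zero]; positivity) (w := -(u / 2) - v) (by rw [zero_add]; exact hw)
    (A * grassmannExp (-(u • hubbardInteraction L M β 1 + -v • momentumDensity L M β)))
  rw [zero_add] at h
  exact h

/-! ### Real coupling: the Grassmann representation at `μ - u/2` -/

/-- **For real coupling the ratio is the Grassmann two-point ratio at chemical potential `μ - u/2`.**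
[cite: BenfattoGiulianiMastropietro2006, §2.3 (2.21)-(2.24)] -/
theorem hubbardRatio_ofReal {β : ℝ} (hβ : 0 < β) (μ : ℝ) (x y : TorusSite 2 L) (σ σ' : Fin 2) (u : ℝ) :
    hubbardRatio L M β μ x y σ σ' (u : ℂ) =
      gaussExpect ℂ (hubbardCovariance L M β (μ - u / 2) 0)
          (positionField L M β 0 σ x 0 * positionField L M β 1 σ' y 0 * grassmannExp (-hubbardInteraction L M β u)) /
        effPartitionFn ℂ (hubbardCovariance L M β (μ - u / 2) 0) (hubbardInteraction L M β u) := by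
  have hw : |β * (-((u : ℂ) / 2) - 0).im| ≤ Real.pi / 4 := by
    have : (-((u : ℂ) / 2) - 0).im = 0 := by simp
    rw [this, mul_zero, abs_zero]; positivity
  have hN := gaussExpect_shifted_grassmannExp_smul_momentumDensity_ne_zero (L := L) (M := M) hβ μ (θ := 0)
    (by rw [mul_zero, abs_zero]; positivity) (w := -((u : ℂ) / 2) - 0) (by simpa using hw)
  rw [hubbardRatio, hubbardRatioNum, hubbardRatioDen,
    gaussExpect_mul_grassmannExp_neg_hubbardComplexAction hβ μ (u : ℂ) 0 hw,
    show grassmannExp (-hubbardComplexAction L M β (u : ℂ)) = 1 * grassmannExp (-hubbardComplexAction L M β (u : ℂ)) by rw [one_mul],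
    gaussExpect_mul_grassmannExp_neg_hubbardComplexAction hβ μ (u : ℂ) 0 hw, hubbardCovFullShifted_zero] at *
  rw [mul_div_mul_left _ _ hN]
  have hre : μ + (-((u : ℂ) / 2) - 0).re = μ - u / 2 := by simp; ring
  have him : (-((u : ℂ) / 2) - 0).im = 0 := by simp
  rw [hre, him, hubbardCovFullShifted_zero, neg_zero, zero_smul, add_zero, ← hubbardInteraction_eq_smul_one, one_mul,
    ← effPartitionFn_eq_gaussExpect]

/-! ### Complex coupling: the grid representation with a Hartree counterterm -/

/-- The grid substitution realises the initial fields at time `0`. [cite: BenfattoGiulianiMastropietro2006, §2.1 (2.5)] -/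
theorem map_hubbardGridSub_gen_zero [NeZero N] (β : ℝ) (x : TorusSite 2 L) (σ c : Fin 2) :
    ExteriorAlgebra.map (Matrix.toLin' (hubbardGridSub L M β N)) (gen ℂ ((((((0 : Fin N), x) : GridPoint L N), σ), c) : GridLeg (GridPoint L N))) =
      positionField L M β c σ x 0 := by
  rw [hubbardGridSub, map_gridSub_gen]
  simp [gridTime]

/-- The tracked grid interaction is pulled back onto `u V₁ + ν N̂` (`2M ≤ N`, `4M ≤ N + 1`, `β ≠ 0`).
[cite: BenfattoGiulianiMastropietro2006, §2.1 (2.5)-(2.6a)] -/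
theorem map_hubbardGridSub_gridTracked [NeZero N] {β : ℝ} (hβ : β ≠ 0) (hN : 2 * M ≤ N) (hN' : 4 * M ≤ N + 1) (u ν : ℂ) :
    ExteriorAlgebra.map (Matrix.toLin' (hubbardGridSub L M β N)) (gridTracked L N β u ν) =
      u • hubbardInteraction L M β 1 + ν • momentumDensity L M β := by
  rw [gridTracked, map_add, map_smul, map_smul, map_hubbardGridSub_gridInteraction hβ 1 hN', map_hubbardGridSub_gridQuadratic hβ hN]

/-- **For complex coupling the ratio is the grid two-point ratio with a Hartree counterterm**: for every `v` (`= uT`) with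
`|β·Im(u/2 + v)| ≤ π/4`, `2M ≤ N`, `4M ≤ N + 1`,
`R_{L,M}(u) = ⟨ψ_{X₀} ψ_{Y₀} e^{-(uV₁^{grid} - v N₂^{grid})}⟩_{Sᵀ C^θ_{μ_R} S} / Z`, `μ_R + iθ = μ - u/2 - v`.
[cite: BenfattoGiulianiMastropietro2006, §2.2 (2.12)-(2.14)] -/
theorem hubbardRatio_eq_grid [NeZero N] {β : ℝ} (hβ : 0 < β) (μ : ℝ) (x y : TorusSite 2 L) (σ σ' : Fin 2) (u v : ℂ)
    (hw : |β * (-(u / 2) - v).im| ≤ Real.pi / 4) (hN : 2 * M ≤ N) (hN' : 4 * M ≤ N + 1) :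
    hubbardRatio L M β μ x y σ σ' u =
      gaussExpect ℂ ((hubbardGridSub L M β N).transpose * hubbardCovFullShifted L M β (μ + (-(u / 2) - v).re) (-(u / 2) - v).im *
          hubbardGridSub L M β N)
          (gen ℂ ((((((0 : Fin N), x) : GridPoint L N), σ), 0) : GridLeg (GridPoint L N)) *
            gen ℂ ((((((0 : Fin N), y) : GridPoint L N), σ'), 1) : GridLeg (GridPoint L N)) * grassmannExp (-gridTracked L N β u (-v))) /
        effPartitionFn ℂ ((hubbardGridSub L M β N).transpose * hubbardCovFullShifted L M β (μ + (-(u / 2) - v).re) (-(u / 2) - v).im *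
          hubbardGridSub L M β N) (gridTracked L N β u (-v)) := by
  have hN0 := gaussExpect_shifted_grassmannExp_smul_momentumDensity_ne_zero (L := L) (M := M) hβ μ (θ := 0)
    (by rw [mul_zero, abs_zero]; positivity) (w := -(u / 2) - v) (by simpa using hw)
  rw [hubbardRatio, hubbardRatioNum, hubbardRatioDen,
    gaussExpect_mul_grassmannExp_neg_hubbardComplexAction hβ μ u v hw,
    show grassmannExp (-hubbardComplexAction L M β u) = 1 * grassmannExp (-hubbardComplexAction L M β u) by rw [one_mul],
    gaussExpect_mul_grassmannExp_neg_hubbardComplexAction hβ μ u v hw, hubbardCovFullShifted_zero] at *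
  rw [mul_div_mul_left _ _ hN0, one_mul]
  -- pull back along the grid substitution
  have hsub : positionField L M β 0 σ x 0 * positionField L M β 1 σ' y 0 *
      grassmannExp (-(u • hubbardInteraction L M β 1 + (-v) • momentumDensity L M β)) =
      ExteriorAlgebra.map (Matrix.toLin' (hubbardGridSub L M β N))
        (gen ℂ ((((((0 : Fin N), x) : GridPoint L N), σ), 0) : GridLeg (GridPoint L N)) *
          gen ℂ ((((((0 : Fin N), y) : GridPoint L N), σ'), 1) : GridLeg (GridPoint L N)) * grassmannExp (-gridTracked L N β u (-v))) := by
    rw [map_mul, map_mul, map_hubbardGridSub_gen_zero, map_hubbardGridSub_gen_zero, map_grassmannExp_eq, map_neg,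
      map_hubbardGridSub_gridTracked hβ.ne' hN hN']
  have hsub' : grassmannExp (-(u • hubbardInteraction L M β 1 + (-v) • momentumDensity L M β)) =
      ExteriorAlgebra.map (Matrix.toLin' (hubbardGridSub L M β N)) (grassmannExp (-gridTracked L N β u (-v))) := by
    rw [map_grassmannExp_eq, map_neg, map_hubbardGridSub_gridTracked hβ.ne' hN hN']
  rw [hsub, hsub', gaussExpect_map, gaussExpect_map, LinearMap.toMatrix'_toLin', effPartitionFn_eq_gaussExpect]

/-! ### Holomorphy in the coupling -/

/-- **The building blocks are polynomials in `u`**: for every `A`, `u ↦ ∫dμ_C A e^{-(uV₁ + (u/2)N̂)}` is differentiable on `ℂ`.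
[cite: BenfattoGiulianiMastropietro2006, Thm 2.1] -/
theorem differentiable_gaussExpect_mul_grassmannExp_neg_hubbardComplexAction (β μ : ℝ) (A : HubbardGrassmann L M) :
    Differentiable ℂ fun u : ℂ => gaussExpect ℂ (hubbardCovariance L M β μ 0) (A * grassmannExp (-hubbardComplexAction L M β u)) := by
  classical
  set B : HubbardGrassmann L M := hubbardInteraction L M β 1 + (1 / 2 : ℂ) • momentumDensity L M β with hB
  have hact : ∀ u : ℂ, -hubbardComplexAction L M β u = (-u) • B := by
    intro u; rw [hubbardComplexAction, hB, smul_add, smul_smul]; simp only [neg_smul, neg_add]; congr 1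
    rw [show -u * (1 / 2) = -(u / 2) by ring, neg_smul]
  have hB0 : constPart ℂ B = 0 := by
    have hV0 : constPart ℂ (hubbardInteraction L M β 1) = 0 := constPart_hubbardInteraction L M β 1
    have hQ0 : constPart ℂ (momentumDensity L M β) = 0 := by
      have := constPart_eq_zero_of_eq_quadratic _ (smul_momentumDensity_eq_sum (L := L) (M := M) β 1)
      simpa using this
    simp [hB, hV0, hQ0]
  set n := Fintype.card (HubbardFieldIdx L M) + 1 with hn
  have hpow : ∀ u : ℂ, ((-u) • B) ^ n = 0 := by
    intro u; rw [smul_pow, pow_card_succ_eq_zero_of_constPart_eq_zero ℂ hB0, smul_zero]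
  have hexp : ∀ u : ℂ, grassmannExp (-hubbardComplexAction L M β u) = ∑ i ∈ range n, ((-u) ^ i * (i.factorial : ℂ)⁻¹) • B ^ i := by
    intro u
    rw [hact, grassmannExp, IsNilpotent.exp_eq_sum (hpow u)]
    refine sum_congr rfl fun i _ => ?_
    rw [smul_pow, ← Rat.cast_smul_eq_qsmul ℂ, smul_smul]
    congr 1
    push_cast
    ring
  have hfun : (fun u : ℂ => gaussExpect ℂ (hubbardCovariance L M β μ 0) (A * grassmannExp (-hubbardComplexAction L M β u))) =
      fun u : ℂ => ∑ i ∈ range n, ((-u) ^ i * (i.factorial : ℂ)⁻¹) * gaussExpect ℂ (hubbardCovariance L M β μ 0) (A * B ^ i) := by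
    funext u
    rw [hexp, mul_sum, map_sum]
    refine sum_congr rfl fun i _ => ?_
    rw [mul_smul_comm, map_smul, smul_eq_mul]
  rw [hfun]
  refine Differentiable.fun_sum fun i _ => ?_
  exact (((differentiable_id.neg).pow i).mul (differentiable_const _)).mul (differentiable_const _)

/-- The numerator is entire. [cite: BenfattoGiulianiMastropietro2006, Thm 2.1] -/
theorem differentiable_hubbardRatioNum (β μ : ℝ) (x y : TorusSite 2 L) (σ σ' : Fin 2) :
    Differentiable ℂ (hubbardRatioNum L M β μ x y σ σ') :=
  differentiable_gaussExpect_mul_grassmannExp_neg_hubbardComplexAction β μ _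

/-- The denominator is entire. [cite: BenfattoGiulianiMastropietro2006, Thm 2.1] -/
theorem differentiable_hubbardRatioDen (β μ : ℝ) : Differentiable ℂ (hubbardRatioDen L M β μ) := by
  have h := differentiable_gaussExpect_mul_grassmannExp_neg_hubbardComplexAction (L := L) (M := M) β μ 1
  have hfun : hubbardRatioDen L M β μ = fun u => gaussExpect ℂ (hubbardCovariance L M β μ 0) (1 * grassmannExp (-hubbardComplexAction L M β u)) := by
    funext u; rw [hubbardRatioDen, one_mul]
  rw [hfun]; exact h

/-- **The ratio is holomorphic where the denominator does not vanish.** [cite: BenfattoGiulianiMastropietro2006, Thm 2.1] -/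
theorem differentiableOn_hubbardRatio (β μ : ℝ) (x y : TorusSite 2 L) (σ σ' : Fin 2) {s : Set ℂ}
    (hs : ∀ u ∈ s, hubbardRatioDen L M β μ u ≠ 0) : DifferentiableOn ℂ (hubbardRatio L M β μ x y σ σ') s := fun u hu =>
  (((differentiable_hubbardRatioNum β μ x y σ σ') u).div ((differentiable_hubbardRatioDen β μ) u) (hs u hu)).differentiableWithinAt

end Literature.MathematicalPhysics.QuantumLattice

end
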